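import Literature.NumberTheory.EllipticCurves.EmertonPollackWeston2006.NearlyOrdinaryAlgebraicTransfer
import Literature.NumberTheory.EllipticCurves.QuadraticTwistSelmerPInfty
import Literature.NumberTheory.EllipticCurves.TateModuleGaloisTransportProofs
import HarnessLib

/-!
# TB-ROL FILE A: transport of a Greenberg local datum along a SIGN-equivariant isomorphism
# `E₁[p^∞] ≃ E₂[p^∞]` (a quadratic twist), and the five `IsRamifiedOrdinaryLine` clauses after
# transport (team n1011, seat p10 gen 3, OWNERS optional row TB-ROL; lead GEN 6 R5-32 "FILE A
# (generic `p^∞`-level twist transport of a `D_v`-stable subgroup, fact-free) START NOW")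

HONEST FRAMING (cell `b2b-bsdres`, run/shared/lean/b2b/bsd-rank1-residual/, verbatim in every
file): the goal of the cell is to DELETE the COMBINATION-SHAPED residual classes of the
Birch–Swinnerton-Dyer formula for ALL analytic-rank `≤ 1` elliptic curves over `ℚ` — "full BSD
formula for every rank `≤ 1` curve in class `C`" assembled STRICTLY from published theorems — so
that the rank-`≤ 1` remainder becomes exactly the CONSTRUCTION-SHAPED classes, which are TYPED
(missing-input `Prop`s), NOT attempted. This is not "finishing BSD". Team n1011 (N10/N11: X4 ∧
`p = 3`): research route on the CONSTRUCTION-SHAPED class X4; prove what is provable now; no claim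
beyond stated classes; census output = EVIDENCE / conjecture items, never a Literature fact;
X4♯(G-ord) stays CONSTRUCTION-SHAPED; RESIDUAL-MAP marks UNCHANGED; nothing is booked by this file.
Theorems only: NO definition (the transported datum is produced by an existence theorem together
with its membership characterisation), NO named fact, NO conjecture node. Fact-free: pure
Galois-module algebra.

## What and why

Route G's EPW discharge (`CongruentPartnerMainConjectureGordEPW.lean`, cc-typer-1's
`CongruentLambdaShiftOfEPW.lean`) carries, per additive pair, two RAMIFIED ORDINARY LINES
`IsRamifiedOrdinaryLine Wᵢ p Lᵢ` (EPW 2006 §3.1 (eq:ordes): a `D_v`-stable divisible proper non-zero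
line `C ⊂ E[p^∞]` with inertia acting on `E[p^∞]/C` through a finite NON-TRIVIAL quotient) as
explicit binders. On an X4♯(G-ord) row `E = V ⊗ χ`, `V` good ORDINARY at `p`, `χ` quadratic and
RAMIFIED at `p`, the line is Greenberg's `C_v(V) = ker(V[p^∞] → Ṽ(k̄_v))`
(`X2.GreenbergVatsalReductionDatum.reductionDatum`, in the tree) pushed through the twisting
isomorphism `t : V(ℚ̄) ≃ E(ℚ̄)`, `t(σP) = χ(σ)·σ·t(P)` (Silverman *AEC* X.5 Cor. 5.4; tree:
`exists_addEquiv_geomPoints_quadraticTwist_sign`). This file is the GENERIC half of that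
construction (FILE B, `GordRamifiedOrdinaryLine.lean`, assembles it on the class):

* §1 `exists_localDatum_transport` — for Galois modules `M₁`, `M₂` of a number field `K`, a local
  datum `L` on `M₁` at `v` and an additive isomorphism `e : M₁ ≃+ M₂` which at EVERY `σ ∈ Γ_K` is
  either equivariant or anti-equivariant (`e(σm) = ±σ e(m)`, the sign depending on `σ` only), the
  subgroup `e(L.plus) ≤ M₂` is again `D_v`-stable (subgroups are closed under `−1`): a local datum
  `L₂` on `M₂` with `m ∈ L₂.plus ↔ e⁻¹m ∈ L.plus`. For ANY such `L₂` ("a transport of `L` along `e`")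
  divisibility, `≠ ⊤`, `≠ ⊥` pass from `L` to `L₂` (`transport_divisible`, `…_plus_ne_top`,
  `…_plus_ne_bot`).
* §1 inertia clauses: `e` commutes with `σ²` for every `σ` (`apply_mul_self_smul`), so "inertia acts
  TRIVIALLY on `M₁/C`" (`x•m − m ∈ C`, the `htriv` of `reductionDatum_htriv`) gives "inertia acts on
  `M₂/e(C)` through exponent `2`" (`transport_sq_smul_sub_mem`); and if some inertia element `σ₀`
  is in the ANTI-equivariant branch, `C ≠ ⊤` and `2` is invertible modulo `C`, then `σ₀` MOVES some
  element of `M₂` modulo `e(C)` (`transport_exists_smul_sub_not_mem`: `σ₀•e(m) − e(m) =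
  e(−σ₀m − m) ≡ e(−2m) mod e(C)`).
* §2 on `E[p^∞]`, `p` odd: `2` is invertible modulo every subgroup (`mem_of_two_nsmul_mem`), whence
  the packaged **`isRamifiedOrdinaryLine_of_transport`**: a divisible, proper, non-zero,
  inertia-TRIVIAL local datum on `E₁[p^∞]` and a sign-equivariant `e : E₁[p^∞] ≃+ E₂[p^∞]` with ONE
  anti-equivariant inertia element make EVERY transport `L₂` of `L` along `e` a ramified ordinary
  line, `IsRamifiedOrdinaryLine W₂ p L₂` (`n = 2`); `exists_isRamifiedOrdinaryLine_of_signEquivariant`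
  is the existence form.
* §3 the source of such `e`: for a `K`-model `W = C • V^{(d)}` of a quadratic twist,
  `twistPointsIso ∘ f⁻¹` (`f` the tree's signed twisting isomorphism) restricted to `p`-primary
  torsion is equivariant at `σ√d = √d`, anti-equivariant at `σ√d = −√d`
  (`exists_addEquiv_geomPrimaryTorsion_of_model_twist_sign`).

References: Emerton–Pollack–Weston, Invent. Math. 163 (2006) §3.1 [EmertonPollackWeston2006];
Greenberg, LNM 1716 (1999) §2 pp. 62–63, 69 [GreenbergLNM1716]; Silverman *AEC* X.5 Cor. 5.4
[SilvermanAEC2009]; n1011-lit GEN 4 tree map (HOME/INBOX.md 2026-08-21T09:10Z, sheet v20 §28).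
-/

set_option autoImplicit false

noncomputable section

open scoped Classical

open NumberField IsDedekindDomain Field WeierstrassCurve
  Literature.NumberTheory.GaloisRepresentations
  Literature.NumberTheory.EllipticCurves
  Literature.NumberTheory.EllipticCurves.GreenbergSelmer
  Literature.NumberTheory.EllipticCurves.EmertonPollackWeston2006

universe u

namespace Summit.BirchSwinnertonDyer.Rank1Residual.Additive

/-! ### §1 Sign-equivariant isomorphisms of Galois modules; transport of a local datum -/

section Generic

variable {K : Type u} [Field K] [NumberField K] {v : HeightOneSpectrum (𝓞 K)}
  {M₁ M₂ : Type u} [AddCommGroup M₁] [AddCommGroup M₂]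
  [DistribMulAction (absoluteGaloisGroup K) M₁] [DistribMulAction (absoluteGaloisGroup K) M₂]
  (L : LocalDatum K M₁ v) (e : M₁ ≃+ M₂)
  (he : ∀ σ : absoluteGaloisGroup K, (∀ m, e (σ • m) = σ • e m) ∨ (∀ m, e (σ • m) = -(σ • e m)))

omit [NumberField K] in
include he in
/-- The inverse of a sign-equivariant isomorphism is sign-equivariant, with the same sign at each
`σ`. [folklore] -/
theorem symm_smul_of_signEquivariant (σ : absoluteGaloisGroup K) :
    (∀ m, e.symm (σ • m) = σ • e.symm m) ∨ (∀ m, e.symm (σ • m) = -(σ • e.symm m)) := by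
  rcases he σ with h | h
  · exact Or.inl fun m ↦ e.injective (by rw [e.apply_symm_apply, h, e.apply_symm_apply])
  · exact Or.inr fun m ↦ e.injective (by
      rw [e.apply_symm_apply, map_neg, h, e.apply_symm_apply, neg_neg])

omit [NumberField K] in
include he in
/-- A sign-equivariant isomorphism COMMUTES with `σ²` for every `σ` (`(±1)² = 1`). [folklore] -/
theorem apply_mul_self_smul (σ : absoluteGaloisGroup K) (m : M₁) :
    e ((σ * σ) • m) = (σ * σ) • e m := by
  rw [mul_smul, mul_smul]
  rcases he σ with h | h
  · rw [h, h]
  · rw [h, h, smul_neg, neg_neg]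

omit [NumberField K] in
include he in
/-- The inverse of a sign-equivariant isomorphism commutes with `σ²`. [folklore] -/
theorem symm_apply_mul_self_smul (σ : absoluteGaloisGroup K) (m : M₂) :
    e.symm ((σ * σ) • m) = (σ * σ) • e.symm m := by
  apply e.injective
  rw [e.apply_symm_apply, apply_mul_self_smul e he, e.apply_symm_apply]

include he in
/-- **The transported local datum `e(C)` exists.** For a local datum `L` (`C = L.plus ≤ M₁`, stable
under the decomposition group `D_v`) and a sign-equivariant `e : M₁ ≃+ M₂`, the subgroup
`e(C) = {m : e⁻¹ m ∈ C} ≤ M₂` is `D_v`-stable — `e⁻¹(δ•m) = ±δ•e⁻¹(m) ∈ C` — so it is the `plus` of a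
local datum `L₂` on `M₂`, characterised by `m ∈ L₂.plus ↔ e⁻¹ m ∈ C`. This is the line
`A'_{f̃,a} = t(C_v(V)) ⊂ E[p^∞]` of EPW §3.1 when `e = t` is the twisting isomorphism and `C = C_v(V)`
Greenberg's kernel-of-reduction line of the good-ordinary twist.
[cite: EmertonPollackWeston2006, §3.1 (eq:ordes) (arXiv:math/0404484 p. 17)]
[cite: GreenbergLNM1716, §2 pp. 62–63] -/
theorem exists_localDatum_transport :
    ∃ L₂ : LocalDatum K M₂ v, ∀ m : M₂, m ∈ L₂.plus ↔ e.symm m ∈ L.plus := by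
  refine ⟨{ plus := L.plus.comap e.symm.toAddMonoidHom, smul_mem := fun σ {m} hm ↦ ?_ }, fun m ↦ Iff.rfl⟩
  rw [AddSubgroup.mem_comap, AddEquiv.coe_toAddMonoidHom] at hm ⊢
  rcases symm_smul_of_signEquivariant e he (absGaloisRestrict K (v.adicCompletion K) σ) with h | h
  · rw [h]
    exact L.smul_mem σ hm
  · rw [h]
    exact neg_mem (L.smul_mem σ hm)

variable (L₂ : LocalDatum K M₂ v) (hL₂ : ∀ m : M₂, m ∈ L₂.plus ↔ e.symm m ∈ L.plus)

include hL₂ in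
/-- For a transport `L₂` of `L` along `e`: `e m ∈ L₂.plus ↔ m ∈ L.plus`. [folklore] -/
theorem apply_mem_plus_iff_of_transport (m : M₁) : e m ∈ L₂.plus ↔ m ∈ L.plus := by
  rw [hL₂, e.symm_apply_apply]

include hL₂ in
/-- **Divisibility transports**: if `C` is `p`-divisible then so is `e(C)`.
[cite: EmertonPollackWeston2006, §3.1 (eq:ordes) (arXiv:math/0404484 p. 17)] -/
theorem transport_divisible {p : ℕ} (hdiv : ∀ m ∈ L.plus, ∃ m' ∈ L.plus, p • m' = m) :
    ∀ m ∈ L₂.plus, ∃ m' ∈ L₂.plus, p • m' = m := by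
  intro m hm
  obtain ⟨m', hm', hpm'⟩ := hdiv (e.symm m) ((hL₂ m).1 hm)
  refine ⟨e m', (apply_mem_plus_iff_of_transport L e L₂ hL₂ m').2 hm', ?_⟩
  rw [← map_nsmul, hpm', e.apply_symm_apply]

include hL₂ in
/-- **Properness transports**: `C ≠ M₁ ⟹ e(C) ≠ M₂`. [folklore] -/
theorem transport_plus_ne_top (h : L.plus ≠ ⊤) : L₂.plus ≠ ⊤ := by
  intro htop
  refine h (eq_top_iff.2 fun m _ ↦ (apply_mem_plus_iff_of_transport L e L₂ hL₂ m).1 ?_)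
  rw [htop]; exact AddSubgroup.mem_top _

include hL₂ in
/-- **Non-vanishing transports**: `C ≠ 0 ⟹ e(C) ≠ 0`. [folklore] -/
theorem transport_plus_ne_bot (h : L.plus ≠ ⊥) : L₂.plus ≠ ⊥ := by
  intro hbot
  refine h (eq_bot_iff.2 fun m hm ↦ ?_)
  have hm' : e m ∈ L₂.plus := (apply_mem_plus_iff_of_transport L e L₂ hL₂ m).2 hm
  rw [hbot, AddSubgroup.mem_bot, EmbeddingLike.map_eq_zero_iff] at hm'
  exact hm' ▸ AddSubgroup.zero_mem _

include he hL₂ in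
/-- **Inertia acts on `M₂/e(C)` through exponent `2`** when it acts TRIVIALLY on `M₁/C`: for
`σ ∈ I_v` and `m ∈ M₂`, `σ²•m − m ∈ e(C)`, because `e⁻¹(σ²•m) = σ²•e⁻¹(m)` and
`σ²m₁ − m₁ = (σ(σm₁) − σm₁) + (σm₁ − m₁)`. (EPW §3.1: on `A''_{f̃,a} = E[p^∞]/C` inertia acts through
`ω^a`; here `a = (p−1)/2`, `ω^a` quadratic.) [cite: EmertonPollackWeston2006, §3.1 (eq:ordes) (arXiv:math/0404484 p. 17)] -/
theorem transport_sq_smul_sub_mem (htriv : ∀ x ∈ inertia v, ∀ m : M₁, x • m - m ∈ L.plus) :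
    ∀ σ ∈ absInertia (v.adicCompletion K), ∀ m : M₂,
      (absGaloisRestrict K (v.adicCompletion K) σ) ^ 2 • m - m ∈ L₂.plus := by
  intro σ hσ m
  have hxI : absGaloisRestrict K (v.adicCompletion K) σ ∈ inertia v :=
    Subgroup.mem_map.2 ⟨σ, hσ, rfl⟩
  rw [hL₂, map_sub, pow_two, symm_apply_mul_self_smul e he, mul_smul]
  set x := absGaloisRestrict K (v.adicCompletion K) σ
  have hsplit : x • (x • e.symm m) - e.symm m =
      (x • (x • e.symm m) - x • e.symm m) + (x • e.symm m - e.symm m) := by abel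
  rw [hsplit]
  exact add_mem (htriv _ hxI (x • e.symm m)) (htriv _ hxI (e.symm m))

include hL₂ in
/-- **An anti-equivariant inertia element moves `M₂/e(C)`.** If inertia acts trivially on `M₁/C`,
`C ≠ M₁`, `2` is invertible modulo `C` (`2m ∈ C ⟹ m ∈ C`), and `σ₀ ∈ I_v` is in the
ANTI-equivariant branch of `e`, then `σ₀•m − m ∉ e(C)` for `m = e(m₁)`, any `m₁ ∉ C`:
`e⁻¹(σ₀•e m₁ − e m₁) = −σ₀m₁ − m₁ ≡ −2m₁ (mod C)`. (EPW §3.1: `A''` is RAMIFIED on the branch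
`ω^a`, `a ≢ 0`.) [cite: EmertonPollackWeston2006, §3.1 (eq:ordes) (arXiv:math/0404484 p. 17)] -/
theorem transport_exists_smul_sub_not_mem
    (htriv : ∀ x ∈ inertia v, ∀ m : M₁, x • m - m ∈ L.plus) (htop : L.plus ≠ ⊤)
    (h2 : ∀ m : M₁, (2 : ℕ) • m ∈ L.plus → m ∈ L.plus)
    {σ₀ : absoluteGaloisGroup (v.adicCompletion K)} (hσ₀ : σ₀ ∈ absInertia (v.adicCompletion K))
    (hneg : ∀ m : M₁, e (absGaloisRestrict K (v.adicCompletion K) σ₀ • m) =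
      -(absGaloisRestrict K (v.adicCompletion K) σ₀ • e m)) :
    ∃ σ ∈ absInertia (v.adicCompletion K), ∃ m : M₂,
      absGaloisRestrict K (v.adicCompletion K) σ • m - m ∉ L₂.plus := by
  obtain ⟨m₁, hm₁⟩ : ∃ m₁ : M₁, m₁ ∉ L.plus := by
    by_contra! h; exact htop (eq_top_iff.2 fun m _ ↦ h m)
  refine ⟨σ₀, hσ₀, e m₁, fun hmem ↦ hm₁ ?_⟩
  have hx : absGaloisRestrict K (v.adicCompletion K) σ₀ • e m₁ =
      e (-(absGaloisRestrict K (v.adicCompletion K) σ₀ • m₁)) := by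
    rw [map_neg, hneg, neg_neg]
  rw [hL₂, hx, ← map_sub, e.symm_apply_apply] at hmem
  have hxI : absGaloisRestrict K (v.adicCompletion K) σ₀ ∈ inertia v :=
    Subgroup.mem_map.2 ⟨σ₀, hσ₀, rfl⟩
  apply h2
  have hsplit : (2 : ℕ) • m₁ = -((-(absGaloisRestrict K (v.adicCompletion K) σ₀ • m₁) - m₁) +
      (absGaloisRestrict K (v.adicCompletion K) σ₀ • m₁ - m₁)) := by
    rw [two_nsmul]; abel
  rw [hsplit]
  exact neg_mem (add_mem hmem (htriv _ hxI m₁))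

end Generic

/-! ### §2 On `E[p^∞]` with `p` odd: the packaged `IsRamifiedOrdinaryLine` after transport -/

section Curve

variable {K : Type u} [Field K] {W₁ W₂ : WeierstrassCurve K} {p : ℕ} [hp : Fact p.Prime]

/-- An element of odd order killed by `2` is zero. [folklore] -/
private theorem eq_zero_of_odd_of_zsmul_eq_zero {A : Type*} [AddCommGroup A] {ℓ : ℕ} (hℓ : Odd ℓ)
    {P : A} (h1 : (ℓ : ℤ) • P = 0) (h2 : (2 : ℤ) • P = 0) : P = 0 := by
  obtain ⟨k, hk⟩ := hℓ
  calc P = (1 : ℤ) • P := (one_smul ℤ P).symm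
    _ = ((ℓ : ℤ) - k * 2) • P := by
        congr 1
        rw [hk]; push_cast; ring
    _ = (ℓ : ℤ) • P - (k : ℤ) • ((2 : ℤ) • P) := by rw [sub_smul, smul_smul]
    _ = 0 := by rw [h1, h2, smul_zero, sub_zero]

/-- **On `E[p^∞]`, `p` odd, `2` is invertible modulo every subgroup**: `2m ∈ C ⟹ m ∈ C` (`m` has
odd order `p^k`, so its class in `E[p^∞]/C`, killed by `2` and by `p^k`, is `0`). [folklore] -/
theorem mem_of_two_nsmul_mem (hp2 : p ≠ 2) (C : AddSubgroup ↥(W₁.geomPrimaryTorsion p))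
    {m : ↥(W₁.geomPrimaryTorsion p)} (h : (2 : ℕ) • m ∈ C) : m ∈ C := by
  obtain ⟨k, hk⟩ := (AddCommGroup.mem_primaryComponent).1 m.2
  have hk' : p ^ k • m = 0 := Subtype.ext (by rw [AddSubmonoidClass.coe_nsmul, hk]; rfl)
  rw [← QuotientAddGroup.eq_zero_iff]
  refine eq_zero_of_odd_of_zsmul_eq_zero ((hp.out.odd_of_ne_two hp2).pow (n := k)) ?_ ?_
  · rw [natCast_zsmul, ← QuotientAddGroup.mk_nsmul, hk', QuotientAddGroup.mk_zero]
  · rw [show (2 : ℤ) = ((2 : ℕ) : ℤ) from rfl, natCast_zsmul, ← QuotientAddGroup.mk_nsmul,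
      QuotientAddGroup.eq_zero_iff]
    exact h

end Curve

section CurveRat

variable {W₁ W₂ : WeierstrassCurve ℚ} {p : ℕ} [hp : Fact p.Prime] {v : HeightOneSpectrum (𝓞 ℚ)}

/-- **`IsRamifiedOrdinaryLine` after a sign-equivariant transport (the generic heart of TB-ROL).**
Let `L` be a local datum on `E₁[p^∞]` at `v`, `p` odd, with `C = L.plus` `p`-DIVISIBLE, `≠ ⊤`, `≠ ⊥`
and inertia acting TRIVIALLY on `E₁[p^∞]/C` (the shape of Greenberg's good-ordinary datum:
`reductionDatum_htriv`), let `e : E₁[p^∞] ≃+ E₂[p^∞]` be sign-equivariant with at least one inertia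
element in the anti-equivariant branch (a quadratic twist RAMIFIED at `v`), and let `L₂` be a
transport of `L` along `e` (`m ∈ L₂.plus ↔ e⁻¹ m ∈ C`). Then `L₂.plus = e(C) ⊂ E₂[p^∞]` is a ramified
ordinary line: divisible, proper, non-zero, inertia acts through exponent `n = 2`, and non-trivially.
EPW §3.1 (eq:ordes) for the member `f̃` of the twisted curve, `A'_{f̃,a} = e(C)`, `a = (p−1)/2`.
[cite: EmertonPollackWeston2006, §3.1 (eq:ordes) (arXiv:math/0404484 p. 17)]
[cite: GreenbergLNM1716, §2 pp. 62–63 and p. 69] -/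
theorem isRamifiedOrdinaryLine_of_transport (hp2 : p ≠ 2)
    (L : LocalDatum ℚ ↥(W₁.geomPrimaryTorsion p) v)
    (e : ↥(W₁.geomPrimaryTorsion p) ≃+ ↥(W₂.geomPrimaryTorsion p))
    (he : ∀ σ : absoluteGaloisGroup ℚ, (∀ m, e (σ • m) = σ • e m) ∨ (∀ m, e (σ • m) = -(σ • e m)))
    (L₂ : LocalDatum ℚ ↥(W₂.geomPrimaryTorsion p) v) (hL₂ : ∀ m, m ∈ L₂.plus ↔ e.symm m ∈ L.plus)
    (hdiv : ∀ m ∈ L.plus, ∃ m' ∈ L.plus, p • m' = m) (htop : L.plus ≠ ⊤) (hbot : L.plus ≠ ⊥)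
    (htriv : ∀ x ∈ inertia v, ∀ m : ↥(W₁.geomPrimaryTorsion p), x • m - m ∈ L.plus)
    (hram : ∃ σ₀ ∈ absInertia (v.adicCompletion ℚ), ∀ m : ↥(W₁.geomPrimaryTorsion p),
      e (absGaloisRestrict ℚ (v.adicCompletion ℚ) σ₀ • m) =
        -(absGaloisRestrict ℚ (v.adicCompletion ℚ) σ₀ • e m)) :
    IsRamifiedOrdinaryLine W₂ p L₂ := by
  obtain ⟨σ₀, hσ₀, hneg⟩ := hram
  exact ⟨transport_divisible L e L₂ hL₂ hdiv, transport_plus_ne_top L e L₂ hL₂ htop,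
    transport_plus_ne_bot L e L₂ hL₂ hbot,
    ⟨2, two_pos, transport_sq_smul_sub_mem L e he L₂ hL₂ htriv⟩,
    transport_exists_smul_sub_not_mem L e L₂ hL₂ htriv htop
      (fun _ hm ↦ mem_of_two_nsmul_mem hp2 L.plus hm) hσ₀ hneg⟩

/-- **Existence form**: such data give a ramified ordinary line `L₂` on `E₂[p^∞]` at `v` WITH its
membership characterisation `m ∈ L₂.plus ↔ e⁻¹ m ∈ L.plus`.
[cite: EmertonPollackWeston2006, §3.1 (eq:ordes) (arXiv:math/0404484 p. 17)] -/
theorem exists_isRamifiedOrdinaryLine_of_signEquivariant (hp2 : p ≠ 2)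
    (L : LocalDatum ℚ ↥(W₁.geomPrimaryTorsion p) v)
    (e : ↥(W₁.geomPrimaryTorsion p) ≃+ ↥(W₂.geomPrimaryTorsion p))
    (he : ∀ σ : absoluteGaloisGroup ℚ, (∀ m, e (σ • m) = σ • e m) ∨ (∀ m, e (σ • m) = -(σ • e m)))
    (hdiv : ∀ m ∈ L.plus, ∃ m' ∈ L.plus, p • m' = m) (htop : L.plus ≠ ⊤) (hbot : L.plus ≠ ⊥)
    (htriv : ∀ x ∈ inertia v, ∀ m : ↥(W₁.geomPrimaryTorsion p), x • m - m ∈ L.plus)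
    (hram : ∃ σ₀ ∈ absInertia (v.adicCompletion ℚ), ∀ m : ↥(W₁.geomPrimaryTorsion p),
      e (absGaloisRestrict ℚ (v.adicCompletion ℚ) σ₀ • m) =
        -(absGaloisRestrict ℚ (v.adicCompletion ℚ) σ₀ • e m)) :
    ∃ L₂ : LocalDatum ℚ ↥(W₂.geomPrimaryTorsion p) v,
      (∀ m, m ∈ L₂.plus ↔ e.symm m ∈ L.plus) ∧ IsRamifiedOrdinaryLine W₂ p L₂ := by
  obtain ⟨L₂, hL₂⟩ := exists_localDatum_transport L e he
  exact ⟨L₂, hL₂, isRamifiedOrdinaryLine_of_transport hp2 L e he L₂ hL₂ hdiv htop hbot htriv hram⟩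

end CurveRat

/-! ### §3 The source of sign-equivariant isomorphisms: `K`-models of quadratic twists -/

section Source

variable {K : Type u} [Field K] {W₁ W₂ : WeierstrassCurve K} (p : ℕ)

/-- Restriction to `p`-primary torsion preserves EQUIVARIANCE at `σ`. [folklore] -/
theorem primaryComponentCongr_smul_of_smul (g : geomPoints W₁ ≃+ geomPoints W₂)
    {σ : absoluteGaloisGroup K} (h : ∀ P, g (σ • P) = σ • g P) (m : ↥(W₁.geomPrimaryTorsion p)) :
    primaryComponentCongr g p (σ • m) = σ • primaryComponentCongr g p m :=
  Subtype.ext (by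
    simp only [coe_primaryComponentCongr, primaryComponent.coe_smul]
    exact h _)

/-- Restriction to `p`-primary torsion preserves ANTI-equivariance at `σ`. [folklore] -/
theorem primaryComponentCongr_smul_of_smul_neg (g : geomPoints W₁ ≃+ geomPoints W₂)
    {σ : absoluteGaloisGroup K} (h : ∀ P, g (σ • P) = -(σ • g P))
    (m : ↥(W₁.geomPrimaryTorsion p)) :
    primaryComponentCongr g p (σ • m) = -(σ • primaryComponentCongr g p m) :=
  Subtype.ext (by
    simp only [coe_primaryComponentCongr, primaryComponent.coe_smul, NegMemClass.coe_neg]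
    exact h _)

/-- A sign-equivariant `g : E₁(K̄) ≃+ E₂(K̄)` restricts to a sign-equivariant
`E₁[p^∞] ≃+ E₂[p^∞]`. [folklore] -/
theorem primaryComponentCongr_signEquivariant (g : geomPoints W₁ ≃+ geomPoints W₂)
    (hg : ∀ σ : absoluteGaloisGroup K, (∀ P, g (σ • P) = σ • g P) ∨ (∀ P, g (σ • P) = -(σ • g P))) :
    ∀ σ : absoluteGaloisGroup K,
      (∀ m : ↥(W₁.geomPrimaryTorsion p),
        primaryComponentCongr g p (σ • m) = σ • primaryComponentCongr g p m) ∨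
      (∀ m : ↥(W₁.geomPrimaryTorsion p),
        primaryComponentCongr g p (σ • m) = -(σ • primaryComponentCongr g p m)) := by
  intro σ
  rcases hg σ with h | h
  · exact Or.inl (primaryComponentCongr_smul_of_smul p g h)
  · exact Or.inr (primaryComponentCongr_smul_of_smul_neg p g h)

variable [NeZero (2 : K)]

/-- **The twisting isomorphism of a `K`-MODEL of a quadratic twist, with its signs.** For
`W = C • V^{(d)}` over `K` (`d ≠ 0`) there is `g : V(K̄) ≃+ W(K̄)` with `g(σP) = σ g(P)` when
`σ√d = √d` and `g(σP) = −σ g(P)` when `σ√d = −√d`: compose the inverse of the tree's signed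
`f : V^{(d)}(K̄) ≃+ V(K̄)` (`exists_addEquiv_geomPoints_quadraticTwist_sign`) with the
`Γ_K`-equivariant change of variables `twistPointsIso : V^{(d)}(K̄) ≃+ W(K̄)`. Silverman *AEC* X.5
Cor. 5.4, X.2 Prop. 2.4. [cite: SilvermanAEC2009, X.5 Cor. 5.4 and X.2 Prop. 2.4] -/
theorem exists_addEquiv_geomPoints_of_model_twist_sign (V : WeierstrassCurve K) {d : K} (hd : d ≠ 0)
    {W : WeierstrassCurve K} (hCW : ∃ C : VariableChange K, C • V.quadraticTwist d = W) :
    ∃ g : V.geomPoints ≃+ W.geomPoints,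
      (∀ σ : absoluteGaloisGroup K, σ • geomSqrt d = geomSqrt d → ∀ P, g (σ • P) = σ • g P) ∧
      (∀ σ : absoluteGaloisGroup K, σ • geomSqrt d = -geomSqrt d → ∀ P, g (σ • P) = -(σ • g P)) := by
  obtain ⟨C, hC⟩ := hCW
  obtain ⟨f, hfpos, hfneg⟩ := V.exists_addEquiv_geomPoints_quadraticTwist_sign hd
  refine ⟨f.symm.trans (twistPointsIso hC), fun σ hσ P ↦ ?_, fun σ hσ P ↦ ?_⟩
  · have h1 : f.symm (σ • P) = σ • f.symm P := by
      apply f.injective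
      rw [f.apply_symm_apply, hfpos σ hσ, f.apply_symm_apply]
    simp only [AddEquiv.trans_apply]
    rw [h1, twistPointsIso_smul]
  · have h1 : f.symm (σ • P) = -(σ • f.symm P) := by
      apply f.injective
      rw [f.apply_symm_apply, map_neg, hfneg σ hσ, f.apply_symm_apply, neg_neg]
    simp only [AddEquiv.trans_apply]
    rw [h1, map_neg, twistPointsIso_smul]

/-- **The same on `p`-primary torsion: a sign-equivariant `e : V[p^∞] ≃+ W[p^∞]` for a `K`-model
`W = C • V^{(d)}`**, equivariant at `σ√d = √d`, anti-equivariant at `σ√d = −√d`, hence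
sign-equivariant at every `σ` (`σ√d = ±√d` always, `map_geomSqrt`).
[cite: SilvermanAEC2009, X.5 Cor. 5.4 and X.2 Prop. 2.4] -/
theorem exists_addEquiv_geomPrimaryTorsion_of_model_twist_sign (V : WeierstrassCurve K) {d : K}
    (hd : d ≠ 0) {W : WeierstrassCurve K} (hCW : ∃ C : VariableChange K, C • V.quadraticTwist d = W) :
    ∃ e : ↥(V.geomPrimaryTorsion p) ≃+ ↥(W.geomPrimaryTorsion p),
      (∀ σ : absoluteGaloisGroup K, (∀ m, e (σ • m) = σ • e m) ∨ (∀ m, e (σ • m) = -(σ • e m))) ∧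
      (∀ σ : absoluteGaloisGroup K, σ • geomSqrt d = geomSqrt d → ∀ m, e (σ • m) = σ • e m) ∧
      (∀ σ : absoluteGaloisGroup K, σ • geomSqrt d = -geomSqrt d → ∀ m, e (σ • m) = -(σ • e m)) := by
  obtain ⟨g, hgpos, hgneg⟩ := exists_addEquiv_geomPoints_of_model_twist_sign V hd hCW
  refine ⟨primaryComponentCongr g p, fun σ ↦ ?_,
    fun σ hσ ↦ primaryComponentCongr_smul_of_smul p g (hgpos σ hσ),
    fun σ hσ ↦ primaryComponentCongr_smul_of_smul_neg p g (hgneg σ hσ)⟩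
  rcases map_geomSqrt (absoluteGaloisGroup.toAlgEquiv K σ) d with h | h
  · exact Or.inl (primaryComponentCongr_smul_of_smul p g (hgpos σ h))
  · exact Or.inr (primaryComponentCongr_smul_of_smul_neg p g (hgneg σ h))

end Source

end Summit.BirchSwinnertonDyer.Rank1Residual.Additive

end
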